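import Summits.SmoothPoincare4.SmoothPoincare4.Theorems.CylinderEntropyImmortalAreaToFloorWeightedMonotonicityIdentity
import Summits.SmoothPoincare4.SmoothPoincare4.Theorems.CylinderEntropyCylinderRungTwoStaticMonotonicity
import Summits.SmoothPoincare4.SmoothPoincare4.Theorems.CylinderEntropyCylinderRungTwoGaussianDensityScaleDerivative
import HarnessLib

/-!
# Route `CylinderEntropy`, item `ImmortalAreaToFloor` (stmt-SmoothPoincare4-17197):
# HEIGHT-WEIGHTED static Gaussian monotonicity — derivative and two-scale forms (module Γ2 of
# `BLUEPRINT-17197-c2.md`)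

For a closed immersed cross-section `f : M⁴ → N = S⁴ × ℝ ⊂ ℝ⁶` with smooth unit normal `ν` tangent to
`N`, mean curvature `H` of `(f, ν)`, a height weight `u ∈ C²(ℝ)` with `u ≥ 0`, and the WEIGHTED
Gaussian density `F_u(s) = ∫_M u(z₅) G_s dμ_g`, `G_s(z) = exp(-|z - x₀|²/(4s))/(4πs)²`:
* `hasDerivAt_integral_weighted_gaussianProfile` — `F_U'(τ) = ∫ U G_τ (|r|²/(4τ²) - 2/τ)` for any
  continuous weight `U : M → ℝ` (differentiation under the integral sign, as the landed unweighted
  `hasDerivAt_integral_gaussianProfile`);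
* `weightedGaussianDensity_deriv_lowerBound` — the differential monotonicity inequality
  `F_u'(τ) ≥ -¼ ∫ u G H² - 4 F_u(τ) - ∫ G (u''(1 - ν₅²) - H u' ν₅) + (1/τ) ∫ u' G (r₅ - ν₅⟨r,ν⟩)`
  (the landed square completion applied to the WEIGHTED identity
  `weightedStaticMonotonicity_identity`; the last two integrals are the price of the cutoff and are
  supported where `u' ≠ 0`);
* `weightedTwoScaleMonotonicity` — the integrated form: if the cutoff-error functional is `≤ K`
  (`K ≥ 0`) on `[σ, τ]`, then `e^{4σ} F_u(σ) ≤ e^{4τ} F_u(τ) + e^{4τ} K (τ - σ)`.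
This is the monotonicity formula "for a height-cut piece" of the stacking argument (Allard 1972,
§6; Simon 1983, §17), with a smooth cutoff in place of a boundary term.  Everything here is PROVED.

References: W. K. Allard, Ann. of Math. 95 (1972) §6; L. Simon, *Lectures on GMT* (1983) §17;
K. Ecker, *Regularity Theory for Mean Curvature Flow* (2004), Prop. 3.16–3.17; T. H. Colding,
W. P. Minicozzi II, Ann. of Math. 175 (2012) §3.
-/

-- the prescribed namespace `Summit.SmoothPoincare4.SmoothPoincare4.…` repeats `SmoothPoincare4`
set_option linter.dupNamespace false

noncomputable section

open Bundle Set Function Filter MeasureTheory Module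
open scoped Manifold ContDiff Topology RealInnerProductSpace BigOperators

namespace Summit.SmoothPoincare4.SmoothPoincare4.Cruxes.CylinderRungTwo.KillingFlux

open Literature.Geometry.Riemannian Literature.Geometry.Riemannian.EuclideanHypersurface
open Literature.Geometry.Lorentzian Literature.Geometry.Lorentzian.PseudoRiemannianMetric
open Literature.Geometry.Riemannian.SphericalCylinderEntropy (truncL truncL_apply)
open Literature.Geometry.Manifold.CylinderSlice (padL padL_apply_castSucc padL_apply_last)

section Weighted

variable {M : Type*} [TopologicalSpace M] [ChartedSpace (EuclideanSpace ℝ (Fin 4)) M]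
  [IsManifold (𝓡 4) ∞ M] [CompactSpace M] [T2Space M] [MeasurableSpace M] [BorelSpace M]

/-- **Scale derivative of a WEIGHTED Gaussian density of a closed immersed `M⁴ ↬ ℝ⁶`.**  For a
spacelike immersion `f : M → ℝ⁶` of a compact `M`, a continuous weight `U : M → ℝ`, `x₀ ∈ ℝ⁶` and
`τ > 0`, `F_U(s) = ∫_M U(w) (4πs)⁻² e^{-‖f w - x₀‖²/(4s)} dμ_g(w)` has derivative
`F_U'(τ) = ∫_M U(w) (4πτ)⁻² e^{-‖f w - x₀‖²/(4τ)} (‖f w - x₀‖²/(4τ²) - 2/τ) dμ_g(w)`: differentiation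
under the integral sign on the scales `|s - τ| < τ/2`, the `s`-derivative being bounded there by a
constant (`abs_gaussianProfile_scaleDeriv_le`; `U` and `‖f - x₀‖²` are bounded on the compact `M`).
[cite: ColdingMinicozzi2012, §3] -/
theorem hasDerivAt_integral_weighted_gaussianProfile {f : M → EuclideanSpace ℝ (Fin 6)}
    (hf : (euclideanMetric (EuclideanSpace ℝ (Fin 6))).IsSpacelikeImmersion (𝓡 4) f)
    {U : M → ℝ} (hU : Continuous U) (x₀ : EuclideanSpace ℝ (Fin 6)) {τ : ℝ} (hτ : 0 < τ) :
    HasDerivAt (fun s : ℝ => ∫ w, U w * (Real.exp (-‖f w - x₀‖ ^ 2 / (4 * s)) / (4 * Real.pi * s) ^ 2)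
        ∂riemannianMeasure ((euclideanMetric (EuclideanSpace ℝ (Fin 6))).inducedRiemannianMetric f
          contMDiff_pullbackBilin_holds hf))
      (∫ w, U w * ((Real.exp (-‖f w - x₀‖ ^ 2 / (4 * τ)) / (4 * Real.pi * τ) ^ 2) *
          (‖f w - x₀‖ ^ 2 / (4 * τ ^ 2) - 2 / τ))
        ∂riemannianMeasure ((euclideanMetric (EuclideanSpace ℝ (Fin 6))).inducedRiemannianMetric f
          contMDiff_pullbackBilin_holds hf)) τ := by
  set g₁ := (euclideanMetric (EuclideanSpace ℝ (Fin 6))).inducedRiemannianMetric f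
    contMDiff_pullbackBilin_holds hf with hg₁
  haveI : IsFiniteMeasure (riemannianMeasure g₁) := isFiniteMeasure_riemannianMeasure g₁
  have hfc : Continuous f := hf.contMDiff_self.continuous
  have hcc : Continuous fun w => ‖f w - x₀‖ ^ 2 := by fun_prop
  obtain ⟨C, hC⟩ : ∃ C : ℝ, ∀ w, ‖f w - x₀‖ ^ 2 ≤ C := by
    obtain ⟨C, hC⟩ := isCompact_univ.exists_bound_of_continuousOn
      (f := fun w => ‖f w - x₀‖ ^ 2) hcc.continuousOn
    exact ⟨C, fun w => (Real.le_norm_self _).trans (hC w (mem_univ w))⟩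
  obtain ⟨B, hB⟩ : ∃ B : ℝ, ∀ w, |U w| ≤ B := by
    obtain ⟨B, hB⟩ := isCompact_univ.exists_bound_of_continuousOn (f := U) hU.continuousOn
    exact ⟨B, fun w => by simpa [Real.norm_eq_abs] using hB w (mem_univ w)⟩
  have hτ2 : 0 < τ / 2 := half_pos hτ
  have hball : Metric.ball τ (τ / 2) ∈ 𝓝 τ := Metric.ball_mem_nhds τ hτ2
  have hsI : ∀ s ∈ Metric.ball τ (τ / 2), τ / 2 < s := fun s hs => by
    rw [Metric.mem_ball, Real.dist_eq, abs_lt] at hs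
    linarith [hs.1]
  have key := hasDerivAt_integral_of_dominated_loc_of_deriv_le (μ := riemannianMeasure g₁) (𝕜 := ℝ)
    (F := fun s w => U w * (Real.exp (-‖f w - x₀‖ ^ 2 / (4 * s)) / (4 * Real.pi * s) ^ 2))
    (F' := fun s w => U w * ((Real.exp (-‖f w - x₀‖ ^ 2 / (4 * s)) / (4 * Real.pi * s) ^ 2) *
      (‖f w - x₀‖ ^ 2 / (4 * s ^ 2) - 2 / s)))
    (bound := fun _ => B * (1 / (2 * Real.pi * τ) ^ 2 * (C / τ ^ 2 + 4 / τ)))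
    hball ?_ ?_ ?_ ?_ ?_ ?_
  · exact key.2
  · exact Eventually.of_forall fun s =>
      (Continuous.aestronglyMeasurable (by fun_prop))
  · exact integrable_of_continuous (h := g₁) (by fun_prop)
  · exact Continuous.aestronglyMeasurable (by fun_prop)
  · refine Eventually.of_forall fun w s hs => ?_
    rw [norm_mul, Real.norm_eq_abs, Real.norm_eq_abs]
    exact mul_le_mul (hB w) (abs_gaussianProfile_scaleDeriv_le hτ (hsI s hs) (sq_nonneg _) (hC w))
      (abs_nonneg _) ((abs_nonneg _).trans (hB w))
  · exact integrable_const _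
  · refine Eventually.of_forall fun w s hs => ?_
    exact (hasDerivAt_gaussianProfile_scale (‖f w - x₀‖ ^ 2) (hτ2.trans (hsI s hs))).const_mul (U w)

/-- **The weighted differential monotonicity inequality.**  For a closed immersed cross-section
`f : M⁴ → N` with smooth unit normal `ν` tangent to `N`, mean curvature `H`, a height weight
`u ∈ C²(ℝ)` with `u ≥ 0`, `τ > 0`, `x₀ ∈ ℝ⁶`, `G = G_τ`, `r = f(w) - x₀`:
`-¼ ∫ u(z₅) G H² - 4 ∫ u(z₅) G - ∫ G (u''(z₅)(1 - ν₅²) - H u'(z₅) ν₅) + (1/τ) ∫ u'(z₅) G (r₅ - ν₅⟨r,ν⟩)`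
`  ≤ ∫ u(z₅) G (|r|²/(4τ²) - 2/τ) = F_u'(τ)`.
Proof: subtract the weighted identity (`weightedStaticMonotonicity_identity`) from the right-hand
side; what is left of the `u G`-part has integrand
`u G ((⟨r,n⟩² + ⟨r,ν⟩²)/(4τ²) - (H_n⟨r,n⟩ + H⟨r,ν⟩)/(2τ)) ≥ u (-¼ G H² - 4 G)` pointwise
(`weighted_square_completion_lowerBound`, `0 ≤ H_n = 4 - |ν'|² ≤ 4`, `u ≥ 0`).
[cite: Allard1972, §6] -/
theorem weightedGaussianDensity_deriv_lowerBound {f νf : M → EuclideanSpace ℝ (Fin 6)}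
    (hf : (euclideanMetric (EuclideanSpace ℝ (Fin 6))).IsSpacelikeImmersion (𝓡 4) f)
    (hν : ContMDiff (𝓡 4) 𝓘(ℝ, EuclideanSpace ℝ (Fin 6)) ∞ νf)
    (hun : (euclideanMetric (EuclideanSpace ℝ (Fin 6))).IsUnitNormal (𝓡 4) f νf 1)
    (hN : ∀ x, ∑ i : Fin 5, f x (Fin.castSucc i) ^ 2 = 1)
    (hνN : ∀ x, ∑ i : Fin 5, νf x (Fin.castSucc i) * f x (Fin.castSucc i) = 0)
    (x₀ : EuclideanSpace ℝ (Fin 6)) {τ : ℝ} (hτ : 0 < τ) {u : ℝ → ℝ} (hu : ContDiff ℝ 2 u)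
    (hu0 : ∀ t, 0 ≤ u t) :
    -(1 / 4) * ∫ w, u (f w 5) * (Real.exp (-‖f w - x₀‖ ^ 2 / (4 * τ)) / (4 * Real.pi * τ) ^ 2) *
          (euclideanMetric (EuclideanSpace ℝ (Fin 6))).meanCurvature f contMDiff_pullbackBilin_holds
            hf νf w ^ 2
        ∂riemannianMeasure ((euclideanMetric (EuclideanSpace ℝ (Fin 6))).inducedRiemannianMetric f
          contMDiff_pullbackBilin_holds hf)
      - 4 * ∫ w, u (f w 5) * (Real.exp (-‖f w - x₀‖ ^ 2 / (4 * τ)) / (4 * Real.pi * τ) ^ 2)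
        ∂riemannianMeasure ((euclideanMetric (EuclideanSpace ℝ (Fin 6))).inducedRiemannianMetric f
          contMDiff_pullbackBilin_holds hf)
      - ∫ w, (Real.exp (-‖f w - x₀‖ ^ 2 / (4 * τ)) / (4 * Real.pi * τ) ^ 2) *
          (deriv (deriv u) (f w 5) * (1 - νf w 5 ^ 2)
            - (euclideanMetric (EuclideanSpace ℝ (Fin 6))).meanCurvature f contMDiff_pullbackBilin_holds
                hf νf w * (deriv u (f w 5) * νf w 5))
        ∂riemannianMeasure ((euclideanMetric (EuclideanSpace ℝ (Fin 6))).inducedRiemannianMetric f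
          contMDiff_pullbackBilin_holds hf)
      + (1 / τ) * ∫ w, deriv u (f w 5) * (Real.exp (-‖f w - x₀‖ ^ 2 / (4 * τ)) / (4 * Real.pi * τ) ^ 2) *
          ((f w - x₀) 5 - νf w 5 * ⟪f w - x₀, νf w⟫)
        ∂riemannianMeasure ((euclideanMetric (EuclideanSpace ℝ (Fin 6))).inducedRiemannianMetric f
          contMDiff_pullbackBilin_holds hf) ≤
      ∫ w, u (f w 5) * ((Real.exp (-‖f w - x₀‖ ^ 2 / (4 * τ)) / (4 * Real.pi * τ) ^ 2) *
          (‖f w - x₀‖ ^ 2 / (4 * τ ^ 2) - 2 / τ))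
        ∂riemannianMeasure ((euclideanMetric (EuclideanSpace ℝ (Fin 6))).inducedRiemannianMetric f
          contMDiff_pullbackBilin_holds hf) := by
  set g₁ := (euclideanMetric (EuclideanSpace ℝ (Fin 6))).inducedRiemannianMetric f
    contMDiff_pullbackBilin_holds hf with hg₁
  set Hm : M → ℝ := fun w => (euclideanMetric (EuclideanSpace ℝ (Fin 6))).meanCurvature f
    contMDiff_pullbackBilin_holds hf νf w with hHm
  set G : M → ℝ := fun w => Real.exp (-‖f w - x₀‖ ^ 2 / (4 * τ)) / (4 * Real.pi * τ) ^ 2 with hG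
  set a : M → ℝ := fun w => ⟪f w - x₀, padL (truncL (f w))⟫ with ha
  set b : M → ℝ := fun w => ⟪f w - x₀, νf w⟫ with hb
  set S : M → ℝ := fun w => ∑ i : Fin 5, νf w (Fin.castSucc i) ^ 2 with hS
  set U : M → ℝ := fun w => u (f w 5) with hU
  set U' : M → ℝ := fun w => deriv u (f w 5) with hU'
  set U'' : M → ℝ := fun w => deriv (deriv u) (f w 5) with hU''
  -- the weighted identity
  have hid : ∫ w, (U w * G w * ((‖f w - x₀‖ ^ 2 - a w ^ 2 - b w ^ 2) / (4 * τ ^ 2) - 2 / τ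
        + ((4 - S w) * a w + Hm w * b w) / (2 * τ))
      + G w * (U'' w * (1 - νf w 5 ^ 2) - Hm w * (U' w * νf w 5))
      - (U' w * G w / τ) * ((f w - x₀) 5 - νf w 5 * b w)) ∂riemannianMeasure g₁ = 0 :=
    weightedStaticMonotonicity_identity hf hν hun hN hνN x₀ hτ hu
  -- continuity of all the players
  have hfc : Continuous f := hf.contMDiff_self.continuous
  have hνc : Continuous νf := hν.continuous
  have hGc : Continuous G := continuous_gaussianWeight_comp hf x₀ τ
  have hHc : Continuous Hm := continuous_meanCurvature_euclidean hf hν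
  have hac : Continuous a :=
    (hfc.sub continuous_const).inner ((padL.comp truncL).continuous.comp hfc)
  have hbc : Continuous b := (hfc.sub continuous_const).inner hνc
  have hSc : Continuous S := by
    refine continuous_finsetSum _ fun i _ => ?_
    exact ((EuclideanSpace.proj (Fin.castSucc i) :
      EuclideanSpace ℝ (Fin 6) →L[ℝ] ℝ).continuous.comp hνc).pow 2
  have hrc : Continuous fun w => ‖f w - x₀‖ ^ 2 := (hfc.sub continuous_const).norm.pow 2
  have h5c : Continuous fun w => f w 5 :=
    (EuclideanSpace.proj (5 : Fin 6) : EuclideanSpace ℝ (Fin 6) →L[ℝ] ℝ).continuous.comp hfc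
  have hν5c : Continuous fun w => νf w 5 :=
    (EuclideanSpace.proj (5 : Fin 6) : EuclideanSpace ℝ (Fin 6) →L[ℝ] ℝ).continuous.comp hνc
  have hr5c : Continuous fun w => (f w - x₀) 5 :=
    (EuclideanSpace.proj (5 : Fin 6) : EuclideanSpace ℝ (Fin 6) →L[ℝ] ℝ).continuous.comp
      (hfc.sub continuous_const)
  have huc : Continuous u := hu.continuous
  have hu'c : Continuous (deriv u) := hu.continuous_deriv (by norm_num)
  have hu''c : Continuous (deriv (deriv u)) := by
    have h1 : ContDiff ℝ 1 (deriv u) := hu.deriv'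
    exact h1.continuous_deriv le_rfl
  have hUc : Continuous U := huc.comp h5c
  have hU'c : Continuous U' := hu'c.comp h5c
  have hU''c : Continuous U'' := hu''c.comp h5c
  -- the integrands
  set P : M → ℝ := fun w => U w * (G w * (‖f w - x₀‖ ^ 2 / (4 * τ ^ 2) - 2 / τ)) with hP
  set Q : M → ℝ := fun w => U w * G w * ((‖f w - x₀‖ ^ 2 - a w ^ 2 - b w ^ 2) / (4 * τ ^ 2) - 2 / τ
      + ((4 - S w) * a w + Hm w * b w) / (2 * τ)) with hQ
  set X : M → ℝ := fun w => G w * (U'' w * (1 - νf w 5 ^ 2) - Hm w * (U' w * νf w 5)) with hX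
  set Y : M → ℝ := fun w => U' w * G w * ((f w - x₀) 5 - νf w 5 * b w) with hY
  set R : M → ℝ := fun w => U w * (G w * ((a w ^ 2 + b w ^ 2) / (4 * τ ^ 2)
      - ((4 - S w) * a w + Hm w * b w) / (2 * τ))) with hR
  set L : M → ℝ := fun w => U w * (-(1 / 4) * (G w * Hm w ^ 2) - 4 * G w) with hL
  have hτ0 : τ ≠ 0 := hτ.ne'
  have hPQR : ∀ w, P w = Q w + R w := fun w => by
    simp only [hP, hQ, hR]
    ring
  have hQc : Continuous Q :=
    (hUc.mul hGc).mul (((((hrc.sub (hac.pow 2)).sub (hbc.pow 2)).div_const _).sub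
      continuous_const).add ((((continuous_const.sub hSc).mul hac).add (hHc.mul hbc)).div_const _))
  have hRc : Continuous R :=
    hUc.mul (hGc.mul ((((hac.pow 2).add (hbc.pow 2)).div_const _).sub
      ((((continuous_const.sub hSc).mul hac).add (hHc.mul hbc)).div_const _)))
  have hLc : Continuous L :=
    hUc.mul ((continuous_const.mul (hGc.mul (hHc.pow 2))).sub (continuous_const.mul hGc))
  have hXc : Continuous X :=
    hGc.mul ((hU''c.mul (continuous_const.sub (hν5c.pow 2))).sub (hHc.mul (hU'c.mul hν5c)))
  have hYc : Continuous Y := (hU'c.mul hGc).mul (hr5c.sub (hν5c.mul hbc))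
  have hQi : Integrable Q (riemannianMeasure g₁) := integrable_of_continuous (h := g₁) hQc
  have hRi : Integrable R (riemannianMeasure g₁) := integrable_of_continuous (h := g₁) hRc
  have hLi : Integrable L (riemannianMeasure g₁) := integrable_of_continuous (h := g₁) hLc
  have hXi : Integrable X (riemannianMeasure g₁) := integrable_of_continuous (h := g₁) hXc
  have hYi : Integrable Y (riemannianMeasure g₁) := integrable_of_continuous (h := g₁) hYc
  have hUGi : Integrable (fun w => U w * G w) (riemannianMeasure g₁) :=
    integrable_of_continuous (h := g₁) (hUc.mul hGc)
  have hUGHi : Integrable (fun w => U w * G w * Hm w ^ 2) (riemannianMeasure g₁) :=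
    integrable_of_continuous (h := g₁) ((hUc.mul hGc).mul (hHc.pow 2))
  -- pointwise lower bound `L ≤ R`
  have hLR : ∀ w, L w ≤ R w := fun w => by
    have hb4 := radialMeanCurvature_bounds (norm_eq_one_of_isUnitNormal hun w)
    have h1 := weighted_square_completion_lowerBound (G w) (a w) (b w) (4 - S w) (Hm w) τ
      (gaussianWeight_comp_nonneg f x₀ w) hτ hb4.1 hb4.2
    exact mul_le_mul_of_nonneg_left h1 (hu0 _)
  -- the identity rearranged: `∫ Q = -∫ X + (1/τ) ∫ Y`
  have hid' : ∫ w, Q w ∂riemannianMeasure g₁ =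
      -∫ w, X w ∂riemannianMeasure g₁ + (1 / τ) * ∫ w, Y w ∂riemannianMeasure g₁ := by
    have h1 : ∫ w, (Q w + X w - (1 / τ) * Y w) ∂riemannianMeasure g₁ = 0 := by
      refine (integral_congr_ae (Eventually.of_forall fun w => ?_)).trans hid
      simp only [hQ, hX, hY]
      field_simp
    have hQXi : Integrable (fun w => Q w + X w) (riemannianMeasure g₁) := hQi.add hXi
    rw [integral_sub hQXi (hYi.const_mul _), integral_add hQi hXi, integral_const_mul] at h1
    linarith
  have hPint : ∫ w, P w ∂riemannianMeasure g₁ =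
      ∫ w, R w ∂riemannianMeasure g₁ - ∫ w, X w ∂riemannianMeasure g₁
        + (1 / τ) * ∫ w, Y w ∂riemannianMeasure g₁ := by
    rw [show (fun w => P w) = fun w => Q w + R w from funext hPQR, integral_add hQi hRi, hid']
    ring
  have hLint : ∫ w, L w ∂riemannianMeasure g₁ =
      -(1 / 4) * ∫ w, U w * G w * Hm w ^ 2 ∂riemannianMeasure g₁
        - 4 * ∫ w, U w * G w ∂riemannianMeasure g₁ := by
    have h1 : (fun w => L w) = fun w => -(1 / 4) * (U w * G w * Hm w ^ 2) - 4 * (U w * G w) := by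
      funext w
      simp only [hL]
      ring
    rw [h1, integral_sub (hUGHi.const_mul _) (hUGi.const_mul _), integral_const_mul,
      integral_const_mul]
  have hmono : ∫ w, L w ∂riemannianMeasure g₁ ≤ ∫ w, R w ∂riemannianMeasure g₁ :=
    integral_mono hLi hRi hLR
  -- assemble (the displayed integrands are `U G H²`, `U G`, `X`, `Y`, `P` definitionally)
  have e1 : ∫ w, u (f w 5) * (Real.exp (-‖f w - x₀‖ ^ 2 / (4 * τ)) / (4 * Real.pi * τ) ^ 2) *
      Hm w ^ 2 ∂riemannianMeasure g₁ = ∫ w, U w * G w * Hm w ^ 2 ∂riemannianMeasure g₁ := rfl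
  have e2 : ∫ w, u (f w 5) * (Real.exp (-‖f w - x₀‖ ^ 2 / (4 * τ)) / (4 * Real.pi * τ) ^ 2)
      ∂riemannianMeasure g₁ = ∫ w, U w * G w ∂riemannianMeasure g₁ := rfl
  have e3 : ∫ w, (Real.exp (-‖f w - x₀‖ ^ 2 / (4 * τ)) / (4 * Real.pi * τ) ^ 2) *
      (deriv (deriv u) (f w 5) * (1 - νf w 5 ^ 2) - Hm w * (deriv u (f w 5) * νf w 5))
      ∂riemannianMeasure g₁ = ∫ w, X w ∂riemannianMeasure g₁ := rfl
  have e4 : ∫ w, deriv u (f w 5) * (Real.exp (-‖f w - x₀‖ ^ 2 / (4 * τ)) / (4 * Real.pi * τ) ^ 2) *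
      ((f w - x₀) 5 - νf w 5 * ⟪f w - x₀, νf w⟫) ∂riemannianMeasure g₁ =
      ∫ w, Y w ∂riemannianMeasure g₁ := rfl
  have e5 : ∫ w, u (f w 5) * ((Real.exp (-‖f w - x₀‖ ^ 2 / (4 * τ)) / (4 * Real.pi * τ) ^ 2) *
      (‖f w - x₀‖ ^ 2 / (4 * τ ^ 2) - 2 / τ)) ∂riemannianMeasure g₁ =
      ∫ w, P w ∂riemannianMeasure g₁ := rfl
  rw [e1, e2, e3, e4, e5, hPint, ← hLint]
  linarith

/-- **The weighted two-scale Gaussian monotonicity** ("monotonicity for a height-cut piece").  In the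
setting of `weightedGaussianDensity_deriv_lowerBound`, let `0 < σ ≤ τ` and suppose that on every
scale `s ∈ [σ, τ]` the cutoff-error functional is bounded by a constant `K ≥ 0`:
`¼ ∫ u G_s H² + ∫ G_s (u''(1 - ν₅²) - H u' ν₅) - (1/s) ∫ u' G_s (r₅ - ν₅⟨r,ν⟩) ≤ K`.
Then `e^{4σ} F_u(σ) ≤ e^{4τ} F_u(τ) + e^{4τ} K (τ - σ)`, `F_u(s) = ∫ u(z₅) G_s dμ_g`: the function
`h(s) = e^{4s} F_u(s) + e^{4τ} K s` is non-decreasing on `[σ, τ]` since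
`h' = e^{4s}(4 F_u + F_u') + e^{4τ} K ≥ -e^{4s} K + e^{4τ} K ≥ 0` by the differential inequality.
[cite: Allard1972, §6] -/
theorem weightedTwoScaleMonotonicity {f νf : M → EuclideanSpace ℝ (Fin 6)}
    (hf : (euclideanMetric (EuclideanSpace ℝ (Fin 6))).IsSpacelikeImmersion (𝓡 4) f)
    (hν : ContMDiff (𝓡 4) 𝓘(ℝ, EuclideanSpace ℝ (Fin 6)) ∞ νf)
    (hun : (euclideanMetric (EuclideanSpace ℝ (Fin 6))).IsUnitNormal (𝓡 4) f νf 1)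
    (hN : ∀ x, ∑ i : Fin 5, f x (Fin.castSucc i) ^ 2 = 1)
    (hνN : ∀ x, ∑ i : Fin 5, νf x (Fin.castSucc i) * f x (Fin.castSucc i) = 0)
    (x₀ : EuclideanSpace ℝ (Fin 6)) {σ τ : ℝ} (hσ : 0 < σ) (hστ : σ ≤ τ) {u : ℝ → ℝ}
    (hu : ContDiff ℝ 2 u) (hu0 : ∀ t, 0 ≤ u t) {K : ℝ} (hK : 0 ≤ K)
    (herr : ∀ s ∈ Set.Icc σ τ,
      (1 / 4) * ∫ w, u (f w 5) * (Real.exp (-‖f w - x₀‖ ^ 2 / (4 * s)) / (4 * Real.pi * s) ^ 2) *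
            (euclideanMetric (EuclideanSpace ℝ (Fin 6))).meanCurvature f contMDiff_pullbackBilin_holds
              hf νf w ^ 2
          ∂riemannianMeasure ((euclideanMetric (EuclideanSpace ℝ (Fin 6))).inducedRiemannianMetric f
            contMDiff_pullbackBilin_holds hf)
        + ∫ w, (Real.exp (-‖f w - x₀‖ ^ 2 / (4 * s)) / (4 * Real.pi * s) ^ 2) *
            (deriv (deriv u) (f w 5) * (1 - νf w 5 ^ 2)
              - (euclideanMetric (EuclideanSpace ℝ (Fin 6))).meanCurvature f contMDiff_pullbackBilin_holds
                  hf νf w * (deriv u (f w 5) * νf w 5))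
          ∂riemannianMeasure ((euclideanMetric (EuclideanSpace ℝ (Fin 6))).inducedRiemannianMetric f
            contMDiff_pullbackBilin_holds hf)
        - (1 / s) * ∫ w, deriv u (f w 5) * (Real.exp (-‖f w - x₀‖ ^ 2 / (4 * s)) / (4 * Real.pi * s) ^ 2) *
            ((f w - x₀) 5 - νf w 5 * ⟪f w - x₀, νf w⟫)
          ∂riemannianMeasure ((euclideanMetric (EuclideanSpace ℝ (Fin 6))).inducedRiemannianMetric f
            contMDiff_pullbackBilin_holds hf) ≤ K) :
    Real.exp (4 * σ) * ∫ w, u (f w 5) * (Real.exp (-‖f w - x₀‖ ^ 2 / (4 * σ)) / (4 * Real.pi * σ) ^ 2)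
        ∂riemannianMeasure ((euclideanMetric (EuclideanSpace ℝ (Fin 6))).inducedRiemannianMetric f
          contMDiff_pullbackBilin_holds hf) ≤
      Real.exp (4 * τ) * ∫ w, u (f w 5) * (Real.exp (-‖f w - x₀‖ ^ 2 / (4 * τ)) / (4 * Real.pi * τ) ^ 2)
        ∂riemannianMeasure ((euclideanMetric (EuclideanSpace ℝ (Fin 6))).inducedRiemannianMetric f
          contMDiff_pullbackBilin_holds hf)
      + Real.exp (4 * τ) * K * (τ - σ) := by
  set g₁ := (euclideanMetric (EuclideanSpace ℝ (Fin 6))).inducedRiemannianMetric f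
    contMDiff_pullbackBilin_holds hf with hg₁
  have hfc : Continuous f := hf.contMDiff_self.continuous
  have h5c : Continuous fun w => f w 5 :=
    (EuclideanSpace.proj (5 : Fin 6) : EuclideanSpace ℝ (Fin 6) →L[ℝ] ℝ).continuous.comp hfc
  have hUc : Continuous fun w => u (f w 5) := hu.continuous.comp h5c
  -- the weighted density as a function of the scale
  set F : ℝ → ℝ := fun s => ∫ w, u (f w 5) * (Real.exp (-‖f w - x₀‖ ^ 2 / (4 * s)) /
    (4 * Real.pi * s) ^ 2) ∂riemannianMeasure g₁ with hF
  have hFd : ∀ s, 0 < s → HasDerivAt F (∫ w, u (f w 5) * ((Real.exp (-‖f w - x₀‖ ^ 2 / (4 * s)) /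
      (4 * Real.pi * s) ^ 2) * (‖f w - x₀‖ ^ 2 / (4 * s ^ 2) - 2 / s)) ∂riemannianMeasure g₁) s :=
    fun s hs => hasDerivAt_integral_weighted_gaussianProfile hf hUc x₀ hs
  -- `4 F(s) + F'(s) ≥ -K` on `[σ, τ]`
  have hlow : ∀ s ∈ Set.Icc σ τ, -K ≤ 4 * F s + ∫ w, u (f w 5) *
      ((Real.exp (-‖f w - x₀‖ ^ 2 / (4 * s)) / (4 * Real.pi * s) ^ 2) *
        (‖f w - x₀‖ ^ 2 / (4 * s ^ 2) - 2 / s)) ∂riemannianMeasure g₁ := by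
    intro s hs
    have hs0 : 0 < s := lt_of_lt_of_le hσ hs.1
    have h1 := weightedGaussianDensity_deriv_lowerBound hf hν hun hN hνN x₀ hs0 hu hu0
    have h2 := herr s hs
    simp only [hF]
    linarith
  -- the monotone quantity
  set h : ℝ → ℝ := fun s => Real.exp (4 * s) * F s + Real.exp (4 * τ) * K * s with hh
  have hhd : ∀ s, 0 < s → HasDerivAt h (Real.exp (4 * s) * 4 * F s + Real.exp (4 * s) *
      (∫ w, u (f w 5) * ((Real.exp (-‖f w - x₀‖ ^ 2 / (4 * s)) / (4 * Real.pi * s) ^ 2) *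
        (‖f w - x₀‖ ^ 2 / (4 * s ^ 2) - 2 / s)) ∂riemannianMeasure g₁)
      + Real.exp (4 * τ) * K * 1) s := by
    intro s hs
    have h4 : HasDerivAt (fun s : ℝ => 4 * s) 4 s := by
      simpa using (hasDerivAt_id s).const_mul (4 : ℝ)
    have he : HasDerivAt (fun s => Real.exp (4 * s)) (Real.exp (4 * s) * 4) s :=
      (Real.hasDerivAt_exp (4 * s)).comp s h4
    have hprod := he.mul (hFd s hs)
    have hlin := (hasDerivAt_id s).const_mul (Real.exp (4 * τ) * K)
    exact hprod.add hlin
  have hhd_nonneg : ∀ s ∈ Set.Icc σ τ, 0 ≤ Real.exp (4 * s) * 4 * F s + Real.exp (4 * s) *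
      (∫ w, u (f w 5) * ((Real.exp (-‖f w - x₀‖ ^ 2 / (4 * s)) / (4 * Real.pi * s) ^ 2) *
        (‖f w - x₀‖ ^ 2 / (4 * s ^ 2) - 2 / s)) ∂riemannianMeasure g₁)
      + Real.exp (4 * τ) * K * 1 := by
    intro s hs
    have h1 := hlow s hs
    have hexp : Real.exp (4 * s) ≤ Real.exp (4 * τ) := Real.exp_le_exp.2 (by linarith [hs.2])
    have hexp0 : 0 < Real.exp (4 * s) := Real.exp_pos _
    have h2 : Real.exp (4 * s) * (4 * F s + ∫ w, u (f w 5) *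
        ((Real.exp (-‖f w - x₀‖ ^ 2 / (4 * s)) / (4 * Real.pi * s) ^ 2) *
          (‖f w - x₀‖ ^ 2 / (4 * s ^ 2) - 2 / s)) ∂riemannianMeasure g₁) ≥ -(Real.exp (4 * s) * K) := by
      have := mul_le_mul_of_nonneg_left h1 hexp0.le
      linarith
    nlinarith [mul_le_mul_of_nonneg_right hexp hK]
  have hdiff : ∀ s, 0 < s → DifferentiableAt ℝ h s := fun s hs => (hhd s hs).differentiableAt
  have hcont : ContinuousOn h (Set.Icc σ τ) := fun s hs =>
    (hdiff s (lt_of_lt_of_le hσ hs.1)).continuousAt.continuousWithinAt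
  have hmono : MonotoneOn h (Set.Icc σ τ) := by
    refine monotoneOn_of_deriv_nonneg (convex_Icc σ τ) hcont ?_ ?_
    · intro s hs
      rw [interior_Icc] at hs
      exact (hdiff s (lt_trans hσ hs.1)).differentiableWithinAt
    · intro s hs
      rw [interior_Icc] at hs
      rw [(hhd s (lt_trans hσ hs.1)).deriv]
      exact hhd_nonneg s ⟨hs.1.le, hs.2.le⟩
  have hστ' := hmono (Set.left_mem_Icc.2 hστ) (Set.right_mem_Icc.2 hστ) hστ
  simp only [hh, hF] at hστ' ⊢
  nlinarith [hστ']

end Weighted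

end Summit.SmoothPoincare4.SmoothPoincare4.Cruxes.CylinderRungTwo.KillingFlux

end
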